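import Summits.KontsevichZagierPeriods.KontsevichZagierPeriods.Theses.HurwitzMicroSectors
import Summits.KontsevichZagierPeriods.KontsevichZagierPeriods.Theorems.HurwitzMicroSectorsNormalFormPrinciplePiBoxTransfer

/-! TTRL-lite variant V2265 of stmt-KontsevichZagierPeriods-3869

Variant V2265 = `stub_boxRigidity` (BoxRigidity: two representations on open unit boxes with integrands
of KZ's rational shape and equal values are KZ-equivalent) under the move `fix_nat:m=4; fix_nat:m'=2`
(BOTH dimensions frozen: a box-rational representation on `(0,1)⁴` against one on `(0,1)²`). Verdict of
the attempt seat: **open** — this file is the exact-strength certificate, not a proof of the variant: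

* `stub_boxRigidity_var2265_iff_boxVanishing_four`: V2265 ⟺ **BoxVanishing(4)** — every box-rational
  representation on `(0,1)⁴` of value `0` is a relation (⇒: compare with the zero representation on the
  SQUARE, which is box-rational of value `0` and itself a relation; ⇐: pad the square side to the `4`-box
  by unit intervals, `pad_le`, and subtract on the common box, `sub_same`, both tree);
* `stub_boxRigidity_var2265_iff_boxRigidityLe_four`: V2265 ⟺ BoxRigidity with BOTH dimensions `≤ 4`, i.e.
  Conjecture 1 of Kontsevich–Zagier for every pair of rational integrands on the boxes `(0,1)^{≤ 4}`;
  freezing `(m, m') = (4, 2)` instead of bounding loses nothing (padding), and the `2` is idle;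
* `stub_boxRigidity_var2265_of_statement` / `_of_parent`: Summit ⇒ parent leaf ⇒ V2265, so the variant is
  not refutable short of refuting Conjecture 1 for the tree's calculus;
* what it contains, unconditionally: the whole square fragment V2204 = BoxVanishing(2)
  (`stub_boxRigidity_var2204_of_var2265`), hence — through `sectorTwo_of_stub_boxRigidity_var2204`, file
  `…Variants2204` — Conjecture 1 on every weight-two Hurwitz sector `P(xy)/(1 − (xy)ᴸ)` with NO
  independence input (level 4 = the conclusion of `CatalanSectorTwoFour`, stmt-KontsevichZagierPeriods-3877,
  without its open hypothesis `Indep_ℚ(1, π², G)`), and the genuinely `(4,2)`-shaped pairs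
  `sectorFourTwo_of_stub_boxRigidity_var2265`: `[P(xyzw)/(1 − (xyzw)ᴸ)]` on `(0,1)⁴` (values:
  `ℚ`-combinations of `1` and level-`L` Hurwitz values of weight `4`, e.g.
  `β(4) = Σ (−1)ⁿ/(2n+1)⁴ = ∫ dxdydzdw/(1 + x²y²z²w²)`) against any box-rational representation on
  `(0,1)²` (values `1, π², G, log 2, π log 2, Li₂` values, …): for every `a b : ℚ` the instance
  "`β(4) = a + bG ⇒ [1/(1+x²y²z²w²)]_{□⁴} ∼ [a + b/(1+x²y²)]_{□²}`" is provable today only through the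
  (open) independence of `1, G, β(4)` or an explicit chain of moves (none known). This is the residual goal.
(Contrast: both dimensions `≤ 1` is the theorem `boxRigidity_of_le_one`, by Baker; dimension `2` is the
first open one, and V2265 sits two rungs above it.)
Source: M. Kontsevich, D. Zagier, *Periods* (2001), §1.2 Conjecture 1. Pure proof file, no definitions. -/

-- `Summit.<Summit>.<Problem>` is the tree's mandated summit-side namespace (CONVENTIONS §2); for this
-- single-conjunct summit the two coincide, so the duplicate is deliberate.
set_option linter.dupNamespace false

noncomputable section

namespace Summit.KontsevichZagierPeriods.KontsevichZagierPeriods.Theorems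

open MeasureTheory Set
open Literature.NumberTheory.Transcendental Literature.NumberTheory.Transcendental.KZ
open Summit.KontsevichZagierPeriods.KontsevichZagierPeriods.Theses.HurwitzMicroSectors
open Summit.KontsevichZagierPeriods.HurwitzMicroSectors.NormalFormPrinciple.PiBox
open Summit.KontsevichZagierPeriods.HurwitzMicroSectors.NormalFormPrinciple.PiBox.stub_boxCombineAux
  (pad_le sub_same)

/-! ## V2265 is BoxVanishing in dimension 4 -/

/-- **V2265 ⇒ BoxVanishing(4)**: compare a box-rational `N : IntegralRep 4` of value `0` with the zero
representation on the open unit SQUARE (box-rational, value `0`, itself a relation).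
[cite: KontsevichZagier2001, §1.2 Conjecture 1] -/
theorem boxVanishing_four_of_stub_boxRigidity_var2265
    (h : ∀ (N : IntegralRep 4) (N' : IntegralRep 2), N.domain = {x | ∀ i, x i ∈ Set.Ioo (0:ℝ) 1} → N.IsRational → N'.domain = {x | ∀ i, x i ∈ Set.Ioo (0:ℝ) 1} → N'.IsRational → N.value = N'.value → Equivalent N N')
    (N : IntegralRep 4) (hNd : N.domain = {x | ∀ i, x i ∈ Set.Ioo (0:ℝ) 1}) (hNr : N.IsRational)
    (hv : N.value = 0) : of N ∈ relations := by
  obtain ⟨Z, hZd, hZi⟩ := exists_zeroRep (isSemialgebraic_box 2)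
  have hZ : of Z ∈ relations := of_mem_relations_of_eqOn_zero Z (by simp [hZi, EqOn])
  have hZv : Z.value = 0 := by simp [IntegralRep.value, hZi]
  have hZr : Z.IsRational := ⟨0, 1, fun x _ => by simp, fun x _ => by simp [hZi]⟩
  have h' : of N - of Z ∈ relations := h N Z hNd hNr hZd hZr (by rw [hv, hZv])
  simpa using relations.add_mem h' hZ

/-- **BoxVanishing(4) ⇒ BoxRigidity for all dimensions `m, m' ≤ 4`.** Pad both box-rational
representations to the `4`-box by unit intervals (`pad_le`: one Newton–Leibniz move and two null faces
per interval, tree), subtract the integrands on the common box (`sub_same`, rule 1b), tree); the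
difference is box-rational of value `0` by soundness, hence a relation. [cite: KontsevichZagier2001, §1.2 Conjecture 1] -/
theorem boxRigidityLe_four_of_boxVanishing_four_var2265
    (hvan : ∀ N : IntegralRep 4, N.domain = {x | ∀ i, x i ∈ Set.Ioo (0:ℝ) 1} → N.IsRational →
      N.value = 0 → of N ∈ relations)
    {m m' : ℕ} (hm : m ≤ 4) (hm' : m' ≤ 4) (N : IntegralRep m) (N' : IntegralRep m')
    (hNd : N.domain = {x | ∀ i, x i ∈ Set.Ioo (0:ℝ) 1}) (hNr : N.IsRational)
    (hN'd : N'.domain = {x | ∀ i, x i ∈ Set.Ioo (0:ℝ) 1}) (hN'r : N'.IsRational)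
    (hv : N.value = N'.value) : Equivalent N N' := by
  obtain ⟨R₁, h₁d, h₁r, h₁⟩ := pad_le hm N hNd hNr
  obtain ⟨R₂, h₂d, h₂r, h₂⟩ := pad_le hm' N' hN'd hN'r
  obtain ⟨M, hMd, hMr, hM⟩ := sub_same R₁ R₂ h₁d h₁r h₂d h₂r
  have hv₁ : N.value = R₁.value := Equivalent.value_eq_holds h₁
  have hv₂ : N'.value = R₂.value := Equivalent.value_eq_holds h₂
  have hv₁₂ : R₁.value = R₂.value := by rw [← hv₁, ← hv₂, hv]
  have hMv : M.value = 0 := by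
    have e := relations_le_ker_eval_holds hM
    rw [AddMonoidHom.mem_ker, map_sub, map_sub, eval_of, eval_of, eval_of, hv₁₂, sub_self,
      zero_sub, neg_eq_zero] at e
    exact e
  have h₁₂ : of R₁ - of R₂ ∈ relations := by
    have := relations.add_mem hM (hvan M hMd hMr hMv)
    rwa [sub_add_cancel] at this
  have e : of N - of N' = (of N - of R₁) + (of R₁ - of R₂) - (of N' - of R₂) := by abel
  show of N - of N' ∈ relations
  rw [e]
  exact relations.sub_mem (relations.add_mem h₁ h₁₂) h₂

/-- **BoxVanishing(4) ⇒ V2265** (instance `m = 4`, `m' = 2` of the padding lemma).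
[cite: KontsevichZagier2001, §1.2 Conjecture 1] -/
theorem stub_boxRigidity_var2265_of_boxVanishing_four
    (hvan : ∀ N : IntegralRep 4, N.domain = {x | ∀ i, x i ∈ Set.Ioo (0:ℝ) 1} → N.IsRational →
      N.value = 0 → of N ∈ relations) :
    ∀ (N : IntegralRep 4) (N' : IntegralRep 2), N.domain = {x | ∀ i, x i ∈ Set.Ioo (0:ℝ) 1} → N.IsRational → N'.domain = {x | ∀ i, x i ∈ Set.Ioo (0:ℝ) 1} → N'.IsRational → N.value = N'.value → Equivalent N N' :=
  fun N N' => boxRigidityLe_four_of_boxVanishing_four_var2265 hvan le_rfl (by norm_num) N N'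

/-- **V2265 ⟺ BoxVanishing(4)**: the fully frozen instance `(m, m') = (4, 2)` of `stub_boxRigidity` is
exactly the statement that every box-rational representation on `(0,1)⁴` of value `0` is a relation.
[cite: KontsevichZagier2001, §1.2 Conjecture 1] -/
theorem stub_boxRigidity_var2265_iff_boxVanishing_four :
    (∀ (N : IntegralRep 4) (N' : IntegralRep 2), N.domain = {x | ∀ i, x i ∈ Set.Ioo (0:ℝ) 1} → N.IsRational → N'.domain = {x | ∀ i, x i ∈ Set.Ioo (0:ℝ) 1} → N'.IsRational → N.value = N'.value → Equivalent N N') ↔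
    (∀ N : IntegralRep 4, N.domain = {x | ∀ i, x i ∈ Set.Ioo (0:ℝ) 1} → N.IsRational →
      N.value = 0 → of N ∈ relations) :=
  ⟨boxVanishing_four_of_stub_boxRigidity_var2265, stub_boxRigidity_var2265_of_boxVanishing_four⟩

/-- **V2265 ⟺ BoxRigidity with both dimensions `≤ 4`** (the honest strength of the variant: Conjecture 1
for all pairs of rational integrands on the open unit boxes of dimension at most `4`; the frozen `m' = 2`
is idle and the frozen `m = 4` may be relaxed to `m ≤ 4`). [cite: KontsevichZagier2001, §1.2 Conjecture 1] -/
theorem stub_boxRigidity_var2265_iff_boxRigidityLe_four :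
    (∀ (N : IntegralRep 4) (N' : IntegralRep 2), N.domain = {x | ∀ i, x i ∈ Set.Ioo (0:ℝ) 1} → N.IsRational → N'.domain = {x | ∀ i, x i ∈ Set.Ioo (0:ℝ) 1} → N'.IsRational → N.value = N'.value → Equivalent N N') ↔
    (∀ (m m' : ℕ) (N : IntegralRep m) (N' : IntegralRep m'), m ≤ 4 → m' ≤ 4 →
      N.domain = {x | ∀ i, x i ∈ Set.Ioo (0:ℝ) 1} → N.IsRational →
      N'.domain = {x | ∀ i, x i ∈ Set.Ioo (0:ℝ) 1} → N'.IsRational →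
      N.value = N'.value → Equivalent N N') :=
  ⟨fun h _ _ N N' hm hm' => boxRigidityLe_four_of_boxVanishing_four_var2265
      (boxVanishing_four_of_stub_boxRigidity_var2265 h) hm hm' N N',
    fun h N N' => h 4 2 N N' le_rfl (by norm_num)⟩

/-- **V2265 ⇒ BoxVanishing in every dimension `≤ 4`** (pad to the `4`-box, `pad_le`; the value is
kept by soundness). [cite: KontsevichZagier2001, §1.2 Conjecture 1] -/
theorem boxVanishingLe_four_of_stub_boxRigidity_var2265
    (h : ∀ (N : IntegralRep 4) (N' : IntegralRep 2), N.domain = {x | ∀ i, x i ∈ Set.Ioo (0:ℝ) 1} → N.IsRational → N'.domain = {x | ∀ i, x i ∈ Set.Ioo (0:ℝ) 1} → N'.IsRational → N.value = N'.value → Equivalent N N')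
    {m : ℕ} (hm : m ≤ 4) (N : IntegralRep m) (hNd : N.domain = {x | ∀ i, x i ∈ Set.Ioo (0:ℝ) 1})
    (hNr : N.IsRational) (hv : N.value = 0) : of N ∈ relations := by
  obtain ⟨R, hRd, hRr, hR⟩ := pad_le hm N hNd hNr
  have hRv : R.value = 0 := by rw [← Equivalent.value_eq_holds hR, hv]
  have := relations.add_mem hR (boxVanishing_four_of_stub_boxRigidity_var2265 h R hRd hRr hRv)
  rwa [sub_add_cancel] at this

/-- **Parent ⇒ V2265** (the variant is a specialisation of the leaf `stub_boxRigidity`; the converse is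
not claimed — the parent is BoxVanishing in ALL dimensions). [cite: KontsevichZagier2001, §1.2 Conjecture 1] -/
theorem stub_boxRigidity_var2265_of_parent
    (h : ∀ (m m' : ℕ) (N : IntegralRep m) (N' : IntegralRep m'), N.domain = {x | ∀ i, x i ∈ Set.Ioo (0:ℝ) 1} → N.IsRational → N'.domain = {x | ∀ i, x i ∈ Set.Ioo (0:ℝ) 1} → N'.IsRational → N.value = N'.value → Equivalent N N') :
    ∀ (N : IntegralRep 4) (N' : IntegralRep 2), N.domain = {x | ∀ i, x i ∈ Set.Ioo (0:ℝ) 1} → N.IsRational → N'.domain = {x | ∀ i, x i ∈ Set.Ioo (0:ℝ) 1} → N'.IsRational → N.value = N'.value → Equivalent N N' :=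
  h 4 2

/-- **`KontsevichZagierPeriods ⇒ V2265`**: the variant is a special case of Conjecture 1 for the tree's
calculus — a refutation of the variant would refute the Summit. [cite: KontsevichZagier2001, §1.2 Conjecture 1] -/
theorem stub_boxRigidity_var2265_of_statement (h : _root_.KontsevichZagierPeriods) :
    ∀ (N : IntegralRep 4) (N' : IntegralRep 2), N.domain = {x | ∀ i, x i ∈ Set.Ioo (0:ℝ) 1} → N.IsRational → N'.domain = {x | ∀ i, x i ∈ Set.Ioo (0:ℝ) 1} → N'.IsRational → N.value = N'.value → Equivalent N N' :=
  stub_boxRigidity_var2265_of_parent (leaves_of_statement h).1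

/-! ## What the variant contains, unconditionally -/

/-- **V2265 ⇒ V2204** (the square fragment `m = 2, m' ≤ 2`, i.e. BoxVanishing(2)), two rungs down by
padding. Through `sectorTwo_of_stub_boxRigidity_var2204` (file `…Variants2204`) this is Conjecture 1 on
every weight-two Hurwitz sector `P(xy)/(1 − (xy)ᴸ)` of the square with NO linear-independence input —
level `4` being the conclusion of `CatalanSectorTwoFour` (stmt-KontsevichZagierPeriods-3877) without its
open hypothesis `Indep_ℚ(1, π², G)`. [cite: KontsevichZagier2001, §1.2 Conjecture 1] -/
theorem stub_boxRigidity_var2204_of_var2265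
    (h : ∀ (N : IntegralRep 4) (N' : IntegralRep 2), N.domain = {x | ∀ i, x i ∈ Set.Ioo (0:ℝ) 1} → N.IsRational → N'.domain = {x | ∀ i, x i ∈ Set.Ioo (0:ℝ) 1} → N'.IsRational → N.value = N'.value → Equivalent N N') :
    ∀ (m' : ℕ) (N : IntegralRep 2) (N' : IntegralRep m'), m' ≤ 2 → N.domain = {x | ∀ i, x i ∈ Set.Ioo (0:ℝ) 1} → N.IsRational → N'.domain = {x | ∀ i, x i ∈ Set.Ioo (0:ℝ) 1} → N'.IsRational → N.value = N'.value → Equivalent N N' :=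
  fun _ N N' hm' => boxRigidityLe_four_of_boxVanishing_four_var2265
    (boxVanishing_four_of_stub_boxRigidity_var2265 h) (by norm_num) (hm'.trans (by norm_num)) N N'

/-- A representation on the open unit `4`-box with integrand `P(x₀x₁x₂x₃)/(1 − (x₀x₁x₂x₃)ᴸ)` (`L ≠ 0`)
has KZ's rational shape: numerator `P(X₀X₁X₂X₃)`, denominator `1 − (X₀X₁X₂X₃)ᴸ`, non-vanishing on the
box since `0 ≤ x₀x₁x₂x₃ < 1`. [cite: KontsevichZagier2001, §1.1] -/
theorem isRational_of_sectorFour_var2265 (L : ℕ) (hL : L ≠ 0) (r : IntegralRep 4) (P : Polynomial ℚ)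
    (hr : r.domain = {x | ∀ i, x i ∈ Set.Ioo (0:ℝ) 1})
    (hP : EqOn r.integrand
      (fun x => Polynomial.aeval (x 0 * x 1 * x 2 * x 3) P / (1 - (x 0 * x 1 * x 2 * x 3) ^ L)) r.domain) :
    r.IsRational := by
  refine ⟨Polynomial.aeval (MvPolynomial.X 0 * MvPolynomial.X 1 * MvPolynomial.X 2 * MvPolynomial.X 3 :
      MvPolynomial (Fin 4) ℚ) P,
    1 - (MvPolynomial.X 0 * MvPolynomial.X 1 * MvPolynomial.X 2 * MvPolynomial.X 3) ^ L,
    fun x hx => ?_, fun x hx => ?_⟩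
  · rw [hr] at hx
    simp only [mem_setOf_eq] at hx
    have h0 := hx 0
    have h1 := hx 1
    have h2 := hx 2
    have h3 := hx 3
    simp only [map_sub, map_one, map_pow, map_mul, MvPolynomial.aeval_X]
    have ht01 : 0 ≤ x 0 * x 1 := mul_nonneg h0.1.le h1.1.le
    have ht01' : x 0 * x 1 < 1 := mul_lt_one_of_nonneg_of_lt_one_left h0.1.le h0.2 h1.2.le
    have ht012 : 0 ≤ x 0 * x 1 * x 2 := mul_nonneg ht01 h2.1.le
    have ht012' : x 0 * x 1 * x 2 < 1 := mul_lt_one_of_nonneg_of_lt_one_left ht01 ht01' h2.2.le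
    have ht : 0 ≤ x 0 * x 1 * x 2 * x 3 := mul_nonneg ht012 h3.1.le
    have ht' : x 0 * x 1 * x 2 * x 3 < 1 := mul_lt_one_of_nonneg_of_lt_one_left ht012 ht012' h3.2.le
    exact (sub_pos.2 (pow_lt_one₀ ht ht' hL)).ne'
  · show r.integrand x = MvPolynomial.aeval x (Polynomial.aeval _ P) / MvPolynomial.aeval x _
    rw [hP hx, ← Polynomial.aeval_algHom_apply]
    simp

/-- **V2265 on its own shape, unconditionally: weight-four Hurwitz sectors of the `4`-box against the
square.** A representation on `(0,1)⁴` with integrand `P(xyzw)/(1 − (xyzw)ᴸ)` (`L ≠ 0`; values: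
`ℚ`-combinations of `1` and WEIGHT-FOUR level-`L` Hurwitz values, e.g. `ζ(4) = ∫ dxdydzdw/(1 − xyzw)`,
`β(4) = Σ (−1)ⁿ/(2n+1)⁴ = ∫ dxdydzdw/(1 + x²y²z²w²)`) and ANY box-rational representation on the square
(values: `1`, `π²/6 = ∫∫ dxdy/(1 − xy)`, Catalan's `G = ∫∫ dxdy/(1 + x²y²)`, `log 2`, `π log 2`, `Li₂` and
Clausen values, …) with equal values are KZ-equivalent. Instance: for every `a b : ℚ`,
"`β(4) = a + bG ⇒ [1/(1 + x²y²z²w²)]_{□⁴} ∼ [a + b/(1 + x²y²)]_{□²}`" — decided today by no theorem (the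
`ℚ`-independence of `1, G, β(4)` is open and no chain of moves is known). This is the residual goal of
the variant in its own `(4, 2)` shape. [cite: KontsevichZagier2001, §1.2 Conjecture 1] -/
theorem sectorFourTwo_of_stub_boxRigidity_var2265
    (h : ∀ (N : IntegralRep 4) (N' : IntegralRep 2), N.domain = {x | ∀ i, x i ∈ Set.Ioo (0:ℝ) 1} → N.IsRational → N'.domain = {x | ∀ i, x i ∈ Set.Ioo (0:ℝ) 1} → N'.IsRational → N.value = N'.value → Equivalent N N')
    (L : ℕ) (hL : L ≠ 0) :
    ∀ (r : IntegralRep 4) (r' : IntegralRep 2) (P : Polynomial ℚ),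
      r.domain = {x | ∀ i, x i ∈ Set.Ioo (0:ℝ) 1} →
      EqOn r.integrand
        (fun x => Polynomial.aeval (x 0 * x 1 * x 2 * x 3) P / (1 - (x 0 * x 1 * x 2 * x 3) ^ L)) r.domain →
      r'.domain = {x | ∀ i, x i ∈ Set.Ioo (0:ℝ) 1} → r'.IsRational →
      r.value = r'.value → Equivalent r r' :=
  fun r r' P hr hP hr' hr'r hv => h r r' hr (isRational_of_sectorFour_var2265 L hL r P hr hP) hr' hr'r hv

end Summit.KontsevichZagierPeriods.KontsevichZagierPeriods.Theorems
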